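import Summits.RiemannHypothesis.RiemannHypothesis.Theorems.RuelleBandCofiniteCriticalLineStubZeroLevelNullVectorAux4
import Summits.RiemannHypothesis.RiemannHypothesis.Theorems.RuelleBandCofiniteCriticalLineStubZeroLevelNullVectorAux5
import HarnessLib

/-!
# Stub `stub_zeroLevelNullVector` of line `cofinite-weil-index-staircase` for crux `RuelleBand.CofiniteCriticalLine`
(item stmt-RiemannHypothesis-2064, route route-RiemannHypothesis-RuelleBand; registered stub
`stub_zeroLevelNullVector` of line `cofinite-weil-index-staircase` — "a zero min–max level of the
window form is a null vector", the attainment half of the crossing lemma).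

## What is proved

`stub_zeroLevelNullVector` (registered signature, verbatim): for a window `a > 0`, if the `N`-th
Courant–Fischer level of `Re Q` (`Q = weilQuadratic`) over linearly independent `(N+1)`-tuples of
window test functions, on the unit `L²`-sphere of their span, is exactly `0`, then the closed window
form has a non-zero NULL VECTOR in its form domain, seen from the core of test functions: `u ∈ L²`,
`u ≠ 0`, window tests `gₙ → u` in `L²` with `Re Q(gₙ - gₘ) → 0` and `W(gₙ ⋆ h̃) → 0` for every
window test `h` (`0 ∈ σ_p(A_a)` for the lower-bounded self-adjoint operator of the closed form,
Connes–Consani–Moscovici 2025 (3.23)).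

## Proof

Spectral-theorem route on the FORM side, without closability: the window tests `V` carry the inner
product `⟪x, y⟫ := W(y ⋆ x̃) + C⟪[x], [y]⟫_{L²}`, `C = 1 - L₀` (file 5/5), the `L²` map
`T : V → L²(ℝ)` is bounded and injective and has the sequential compact-embedding property
(`ConnesConsaniMoscovici2025_thm_3_6_holds`, PROVED in the tree); the abstract attainment theorem
(file 4/5: compact Gram operator of the extension to the completion, its eigenbasis, the two
Courant–Fischer halves over the dense core, extraction) gives `v ≠ 0` in `L²` and core `xₙ` with
`[xₙ] → v`, form-Cauchy, `⟪h, xₙ⟫ - C⟪[h], [xₙ]⟫ = W(xₙ ⋆ h̃) → 0`; the level hypothesis is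
transported by `stub_zeroLevelNullVector_outer_transfer` along `V.subtype`.

No definitions, no named facts; the inner-product structure on `↥V` is installed locally
(`letI`, `InnerProductSpace.ofCore`) inside the proof.
-/

set_option linter.dupNamespace false -- justified: the module path repeats `RiemannHypothesis` (summit = problem); header prescribed by the line lead

noncomputable section

open Complex MeasureTheory Filter Set
open scoped BigOperators Topology ComplexConjugate InnerProductSpace

namespace Summit.RiemannHypothesis.RiemannHypothesis.Theorems.RuelleBandCofiniteCriticalLine

open Literature.NumberTheory.LFunctions

/-- **Stub `stub_zeroLevelNullVector` — a zero min–max level is a null vector (attainment).**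
For a window `a > 0`: if the `N`-th Courant–Fischer level of `Re Q` over linearly independent
`(N+1)`-tuples of window test functions (on the unit `L²`-sphere of their span) is exactly `0`, then
the closed window form has a non-zero null vector in its form domain, seen from the core: `u ∈ L²`,
`u ≠ 0`, window tests `gₙ → u` in `L²`, `(gₙ)` form-Cauchy, and `W(gₙ ⋆ h̃) → 0` for every window
test `h` (`0 ∈ σ_p(A_a)` for the lower-bounded self-adjoint operator of the closed form,
Connes–Consani–Moscovici 2025 (3.23); Reed–Simon IV, Thm. XIII.64 with XIII.1–2). Proof: the
window test functions with the inner product `W(y ⋆ x̃) + C⟪x, y⟫_{L²}` form a pre-Hilbert space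
whose `L²` map has the compact-embedding property (`ConnesConsaniMoscovici2025_thm_3_6_holds`);
the abstract attainment theorem `stub_zeroLevelNullVector_abstract` (spectral theorem for the
compact Gram operator of the extension to the completion, Courant–Fischer over the dense core)
produces the null vector. [cite: ConnesConsaniMoscovici2025, Thm. 3.6 and eq. (3.23)] -/
theorem stub_zeroLevelNullVector :
    ∀ (N : ℕ) (a : ℝ), 0 < a →
      sInf {x : ℝ | ∃ g : Fin (N + 1) → ℝ → ℂ,
          (∀ i, IsWeilTest (g i) ∧ tsupport (g i) ⊆ Set.Icc (-a) a) ∧ LinearIndependent ℂ g ∧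
          x = sSup {y : ℝ | ∃ c : Fin (N + 1) → ℂ,
            ∫ t, ‖∑ i, c i * g i t‖ ^ 2 = (1 : ℝ) ∧
            y = (weilQuadratic (fun t => ∑ i, c i * g i t)).re}} = 0 →
      ∃ (u : ℝ → ℂ) (g : ℕ → ℝ → ℂ), MemLp u 2 volume ∧ ¬ (u =ᵐ[volume] 0) ∧
          (∀ n, IsWeilTest (g n) ∧ tsupport (g n) ⊆ Set.Icc (-a) a) ∧
          Tendsto (fun n => ∫ t, ‖g n t - u t‖ ^ 2) atTop (𝓝 0) ∧
          Tendsto (fun q : ℕ × ℕ => (weilQuadratic (g q.1 - g q.2)).re) atTop (𝓝 0) ∧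
          ∀ h : ℝ → ℂ, IsWeilTest h → tsupport h ⊆ Set.Icc (-a) a →
            Tendsto (fun n => weilFunctional (weilConv (g n) (weilReflect h))) atTop (𝓝 0) := by
  intro N a ha hlevel
  classical
  -- the lower-bound constant and the core
  obtain ⟨L₀, hL₀⟩ : ∃ L₀ : ℝ, ∀ g : ℝ → ℂ, IsWeilTest g → tsupport g ⊆ Set.Icc (-a) a →
      L₀ * ∫ t, ‖g t‖ ^ 2 ≤ (weilQuadratic g).re :=
    ⟨_, fun g hg hs => weilQuadratic_re_ge_of_tsupport_subset hg hs⟩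
  obtain ⟨V, hV⟩ := stub_zeroLevelNullVector_exists_submodule a
  have hV' : ∀ g ∈ V, IsWeilTest g ∧ tsupport g ⊆ Set.Icc (-a) a := fun g hg => (hV g).1 hg
  have hV1 : ∀ x : V, IsWeilTest (x : ℝ → ℂ) := fun x => (hV' x x.2).1
  have hV2 : ∀ x : V, tsupport (x : ℝ → ℂ) ⊆ Set.Icc (-a) a := fun x => (hV' x x.2).2
  obtain ⟨L, hLnorm, hLinj, hLsub, hLdist⟩ :=
    stub_zeroLevelNullVector_exists_L2Map V (fun g hg => (hV' g hg).1)
  obtain ⟨core, hcore⟩ := stub_zeroLevelNullVector_exists_core V hV' L hLnorm hL₀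
  set Cst : ℝ := 1 - L₀ with hCst
  -- the pre-Hilbert structure on the core
  letI i1 : NormedAddCommGroup V := @InnerProductSpace.Core.toNormedAddCommGroup ℂ V _ _ _ core
  letI i2 : InnerProductSpace ℂ V := InnerProductSpace.ofCore core.toCore
  have hinner : ∀ x y : V, ⟪x, y⟫_ℂ =
      weilFunctional (weilConv (y : ℝ → ℂ) (weilReflect (x : ℝ → ℂ))) + (Cst : ℂ) * ⟪L x, L y⟫_ℂ :=
    fun x y => hcore x y
  have hLre : ∀ x : V, (⟪L x, L x⟫_ℂ).re = ∫ t, ‖(x : ℝ → ℂ) t‖ ^ 2 := fun x => by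
    rw [← hLnorm, ← RCLike.re_to_complex, inner_self_eq_norm_sq (𝕜 := ℂ)]
  have hnormsq : ∀ x : V,
      ‖x‖ ^ 2 = (weilQuadratic (x : ℝ → ℂ)).re + Cst * ∫ t, ‖(x : ℝ → ℂ) t‖ ^ 2 := fun x => by
    rw [← inner_self_eq_norm_sq (𝕜 := ℂ), hinner, RCLike.re_to_complex, Complex.add_re,
      Complex.re_ofReal_mul, hLre]
    rfl
  -- the bounded `L²` map
  have hLle : ∀ x : V, ‖L x‖ ≤ 1 * ‖x‖ := fun x => by
    rw [one_mul]
    refine le_of_pow_le_pow_left₀ two_ne_zero (norm_nonneg _) ?_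
    rw [hnormsq, hLnorm]
    have h := hL₀ (x : ℝ → ℂ) (hV1 x) (hV2 x)
    rw [hCst]
    nlinarith
  -- (no type ascription: `ℝ → ℂ` carries the product topology, which `↥V` would inherit)
  set T := L.mkContinuous 1 hLle with hT
  have hTapply : ∀ x, T x = L x := fun x => rfl
  have hTinj : Function.Injective T := fun x y hxy => hLinj hxy
  have hTnorm : ∀ x : V, ‖T x‖ ^ 2 = ∫ t, ‖(x : ℝ → ℂ) t‖ ^ 2 := fun x => hLnorm x
  have hQ : ∀ x : V, (weilQuadratic (x : ℝ → ℂ)).re = ‖x‖ ^ 2 - Cst * ‖T x‖ ^ 2 := fun x => by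
    rw [hnormsq, hTnorm]
    ring
  -- the compact embedding (CCM 2025, Thm. 3.6)
  have hcomp : ∀ (x : ℕ → V) (M : ℝ), (∀ n, ‖T (x n)‖ = 1) → (∀ n, ‖x n‖ ≤ M) →
      ∃ (v : Lp ℂ 2 (volume : Measure ℝ)) (φ : ℕ → ℕ), StrictMono φ ∧
        Tendsto (fun n => T (x (φ n))) atTop (𝓝 v) := by
    intro x M hx1 hxM
    have hx1' : ∀ n, ∫ t, ‖(x n : ℝ → ℂ) t‖ ^ 2 = (1 : ℝ) := fun n => by
      rw [← hTnorm, hx1, one_pow]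
    have hbdd : BddAbove (Set.range fun n => (weilQuadratic (x n : ℝ → ℂ)).re) := by
      refine ⟨M ^ 2 - Cst, ?_⟩
      rintro _ ⟨n, rfl⟩
      have h1 := hQ (x n)
      rw [hx1, one_pow, mul_one] at h1
      have h2 : ‖x n‖ ^ 2 ≤ M ^ 2 := pow_le_pow_left₀ (norm_nonneg _) (hxM n) 2
      simp only
      linarith
    exact stub_zeroLevelNullVector_L2Map_subseq V ha hV' L hLdist x hx1' hbdd
  -- `N + 1` linearly independent core elements
  have hdim : ∃ y : Fin (N + 1) → V, LinearIndependent ℂ y := by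
    obtain ⟨g, hg, hli⟩ := stub_zeroLevelNullVector_exists_linearIndependent N ha
    refine ⟨fun i => ⟨g i, (hV _).2 (hg i)⟩, LinearIndependent.of_comp V.subtype ?_⟩
    exact hli
  -- the level hypothesis, transported
  have htransfer := stub_zeroLevelNullVector_outer_transfer T Cst (N := N) V.subtype
    V.injective_subtype (fun g => IsWeilTest g ∧ tsupport g ⊆ Set.Icc (-a) a)
    (fun g => ⟨fun hg => ⟨⟨g, (hV g).2 hg⟩, rfl⟩, fun ⟨x, hx⟩ => hx ▸ hV' x x.2⟩)
    (fun g => (weilQuadratic g).re) (fun g => ∫ t, ‖g t‖ ^ 2) (fun x => hQ x) (fun x => (hTnorm x).symm)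
  have hlevel' : sInf {x : ℝ | ∃ y : Fin (N + 1) → V, LinearIndependent ℂ y ∧
      x = sSup {r : ℝ | ∃ c : Fin (N + 1) → ℂ, ‖T (∑ i, c i • y i)‖ ^ 2 = 1 ∧
        r = ‖∑ i, c i • y i‖ ^ 2 - Cst * ‖T (∑ i, c i • y i)‖ ^ 2}} = 0 := by
    rw [← htransfer]
    exact hlevel
  -- the abstract attainment theorem
  obtain ⟨v, x, hv0, hTx, hcauchy, hweak⟩ :=
    stub_zeroLevelNullVector_abstract T Cst N hTinj hcomp hdim hlevel'
  refine ⟨v, fun n => (x n : ℝ → ℂ), Lp.memLp v, fun h => hv0 (Lp.eq_zero_iff_ae_eq_zero.2 h),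
    fun n => ⟨hV1 _, hV2 _⟩, ?_, ?_, fun h hh hsupp => ?_⟩
  · have h1 : Tendsto (fun n => ‖T (x n) - v‖) atTop (𝓝 0) :=
      tendsto_iff_norm_sub_tendsto_zero.1 hTx
    have h2 := h1.pow 2
    rw [zero_pow two_ne_zero] at h2
    refine h2.congr fun n => ?_
    rw [hTapply, hLdist]
  · refine hcauchy.congr fun q => ?_
    rw [← hQ (x q.1 - x q.2), Submodule.coe_sub]
  · have hw := hweak ⟨h, (hV h).2 ⟨hh, hsupp⟩⟩
    refine hw.congr fun n => ?_
    rw [hinner, hTapply, hTapply]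
    ring

end Summit.RiemannHypothesis.RiemannHypothesis.Theorems.RuelleBandCofiniteCriticalLine

end
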